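import Mathlib
import HarnessLib
import Summits.Ventures.LatticeQCDFlow.Exactness.TransformedKernel
import Summits.Ventures.LatticeQCDFlow.Exactness.KickAngleMap
import Summits.Ventures.LatticeQCDFlow.Exactness.SphereAxisCoordinates
import Summits.Ventures.LatticeQCDFlow.Exactness.SphereKickJacobian
import Summits.Ventures.LatticeQCDFlow.Exactness.SphereKickJacobianTransport

/-!
# The Engel–Schaefer site update is a measurable bijection of the site sphere, and the field-transformed update (THMC) through it is exact for the surface measure

HONEST FRAMING: exact (Metropolis-corrected) sampling algorithms for lattice gauge theory;
figures of merit are autocorrelation/cost numbers at stated couplings and volumes; no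
continuum-physics claim.

Venture `LatticeQCDFlow` (cell pub-lqcd), topic `Exactness`; FANOUT row 7 (`s0-cpn-null`: the
S0-D1 rung — 2D CP⁹, Lüscher's LO trivializing map inside HMC, Engel–Schaefer 2011).  NEW WORK of
the cell over Mathlib (`Continuous.homeoOfEquivCompactToT2`, compactness of spheres in
finite-dimensional spaces, `ProbabilityTheory.Kernel.Invariant` / `IsReversible`) and the tree's
`Exactness/TransformedKernel.lean` (`conjKernel`, `transformedUpdate_invariant/_isReversible`,
`correlation_conjKernel`), `Exactness/KickAngleMap.lean` (`bijOn_kickAngle`,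
`injective_kickAngle`), `Exactness/SphereAxisCoordinates.lean` (`latitudePt`, `axisCoords`),
`Exactness/SphereKickJacobian.lean` (`sphereKick`, `continuous_sphereKick`) and
`Exactness/SphereKickJacobianTransport.lean` (`hasJacobian_sphereKick`, `isoSphere`,
`sphereKick_isoSphere_symm`, `exists_linearIsometryEquiv_apply_eq_polarAxis`); nothing is cited as
a fact.  Printed counterparts, NAMED ONLY: Engel–Schaefer 2011 §2.2 (THMC = HMC in the variables
of the map) and §3 eqs. (15)–(18); Lüscher 2010 §3.

`SphereKickJacobian*.lean` give the exact Jacobian (E–S eq. (18)); exactness of the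
field-transformed update in the tree's kernel form (`TransformedKernel.conjKernel κ F`) also needs
the map to be a measurable BIJECTION of the state space.  This file supplies it for
`|c| ‖J‖ ≤ 1` — the range in which the polar map `θ ↦ θ − κ sin θ` is a bijection of `[0, π]`
(`KickAngleMap.lean`; beyond it the map folds, `SphereGeodesicKick.geodesicKick_not_injOn_sphere`)
— and states the exactness of THMC with the actual site map on the actual surface measure.

## Content

* `axisCoords_apply_fst`, `axisCoords_latitudePt`, **`exists_eq_latitudePt`** — every point of
  `S^{n+1}` is `latitudePt θ w` with `θ = angle e₀ x ∈ [0, π]` (latitude decomposition);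
  `sphereKick_latitudePt_Icc` — the update in latitude coordinates on the CLOSED range `[0, π]`
  (the poles are fixed).
* `injective_/surjective_/bijective_sphereKick_polarAxis`, **`bijective_sphereKick`** — for
  `|c| ‖J‖ ≤ 1` the update is a bijection of the unit sphere of any `(n+2)`-dimensional real
  inner product space (`J = 0`: the identity).
* **`sphereKickEquiv`** — the update as a measurable equivalence `S(V) ≃ᵐ S(V)` (a continuous
  bijection of a compact Hausdorff space is a homeomorphism); `coe_sphereKickEquiv`;
  `hasJacobian_sphereKickEquiv`.
* **`sphereKick_thmc_invariant`** / **`sphereKick_thmc_isReversible`** — THMC WITH THE E–S SITE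
  MAP IS EXACT: for any weight `p ≥ 0` on the site sphere and ANY update `κ` that leaves the
  pulled-back weight `(p ∘ sphereKick) · kickJac(c‖J‖, n, angle J ·) · μ.toSphere` invariant
  (resp. is reversible for it), the update reported through the site map,
  `conjKernel κ sphereKickEquiv`, leaves `p · μ.toSphere` invariant (resp. is reversible for it);
  `sphereKick_thmc_correlation` — and its autocorrelations are those of `O ∘ sphereKick` along `κ`.

NOT CLAIMED: the product over sites and links (the CP(N−1) configuration space; per-site factors
compose by `CheckerboardSweep.lean` / `FlowPushforward.HasJacobian.comp`), the HMC kernel `κ`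
itself, anything quantitative about autocorrelations.
-/

noncomputable section

namespace Summit.Ventures.LatticeQCDFlow.Exactness

open Real Set MeasureTheory Measure InnerProductGeometry Metric ProbabilityTheory
  ProbabilityTheory.Kernel
open scoped ENNReal InnerProductSpace

/-! ## §1 Latitude decomposition of the model sphere -/

section Model

variable (n : ℕ)

/-- The first axis coordinate is the first coordinate. -/
theorem axisCoords_apply_fst (x : EuclideanSpace ℝ (Fin (n + 2))) : (axisCoords n x).1 = x 0 := rfl

/-- Axis coordinates of a latitude point: `(cos θ, sin θ • w)`. -/
theorem axisCoords_latitudePt (θ : ℝ) (w : sphere (0 : EuclideanSpace ℝ (Fin (n + 1))) 1) :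
    axisCoords n (latitudePt n θ w : EuclideanSpace ℝ (Fin (n + 2))) =
      (cos θ, sin θ • (w : EuclideanSpace ℝ (Fin (n + 1)))) := by
  rw [← (axisCoords n).apply_symm_apply (cos θ, sin θ • (w : EuclideanSpace ℝ (Fin (n + 1)))),
    axisCoords_symm_apply_eq, map_smul, coe_latitudePt]

/-- **Latitude decomposition**: every point `x` of `S^{n+1}` is `latitudePt θ w` with
`θ = angle e₀ x` (and `w` the direction of its equatorial component; at the poles any `w`). -/
theorem exists_eq_latitudePt (x : sphere (0 : EuclideanSpace ℝ (Fin (n + 2))) 1) :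
    ∃ w : sphere (0 : EuclideanSpace ℝ (Fin (n + 1))) 1,
      x = latitudePt n (angle (polarAxis n) (x : EuclideanSpace ℝ (Fin (n + 2)))) w := by
  set θ := angle (polarAxis n) (x : EuclideanSpace ℝ (Fin (n + 2))) with hθ
  have hx1 : ‖(x : EuclideanSpace ℝ (Fin (n + 2)))‖ = 1 := norm_eq_of_mem_sphere x
  have hcos : cos θ = (x : EuclideanSpace ℝ (Fin (n + 2))) 0 := by
    rw [hθ, cos_angle, inner_polarAxis, norm_polarAxis, hx1, mul_one, div_one]
  -- the equatorial component and its norm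
  set y : EuclideanSpace ℝ (Fin (n + 1)) := (axisCoords n (x : EuclideanSpace ℝ (Fin (n + 2)))).2 with hy
  have hdec : (x : EuclideanSpace ℝ (Fin (n + 2))) = (axisCoords n).symm (cos θ, y) := by
    rw [hcos, hy, ← axisCoords_apply_fst, Prod.mk.eta, MeasurableEquiv.symm_apply_apply]
  have hny : ‖y‖ ^ 2 = sin θ ^ 2 := by
    have h := norm_sq_axisCoords_symm n (cos θ) y
    rw [← hdec, hx1, one_pow] at h
    nlinarith [sin_sq_add_cos_sq θ]
  have hsin : 0 ≤ sin θ := sin_nonneg_of_nonneg_of_le_pi (angle_nonneg _ _) (angle_le_pi _ _)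
  have hny' : ‖y‖ = sin θ := (sq_eq_sq₀ (norm_nonneg y) hsin).1 hny
  by_cases hy0 : y = 0
  · -- a pole: any equatorial point works
    refine ⟨⟨EuclideanSpace.single 0 1, by simp⟩, Subtype.ext ?_⟩
    have hs : sin θ = 0 := by rw [← hny', hy0, norm_zero]
    rw [hdec, coe_latitudePt, axisCoords_symm_apply_eq, hy0, (equatorEmbed n).map_zero, hs, zero_smul]
  · refine ⟨dirSphere y, Subtype.ext ?_⟩
    rw [hdec, coe_latitudePt, axisCoords_symm_apply_eq, dirSphere_coe hy0, map_smul, hny', smul_smul,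
      mul_inv_cancel₀ (by rw [← hny']; exact norm_ne_zero_iff.2 hy0), one_smul]

/-- **The update in latitude coordinates on the closed range**: for `θ ∈ [0, π]` (poles included,
where the tangential field vanishes and the update is the identity),
`sphereKick c (r • e₀) (latitudePt θ w) = latitudePt (kickAngle (c r) θ) w`. -/
theorem sphereKick_latitudePt_Icc (c : ℝ) {r : ℝ} (hr : 0 < r) {θ : ℝ} (hθ : θ ∈ Icc 0 π)
    (w : sphere (0 : EuclideanSpace ℝ (Fin (n + 1))) 1) :
    sphereKick c (r • polarAxis n) (latitudePt n θ w) = latitudePt n (kickAngle (c * r) θ) w := by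
  by_cases hs : sin θ = 0
  · -- a pole: the tangential part of the field vanishes, the kick is the identity
    have hk : kickAngle (c * r) θ = θ := by rw [kickAngle_apply, hs, mul_zero, sub_zero]
    rw [hk]
    apply Subtype.ext
    have ht : tangentKick (r • polarAxis n) (latitudePt n θ w : EuclideanSpace ℝ (Fin (n + 2))) = 0 := by
      rw [coe_latitudePt, tangentKick_meridian (norm_polarAxis n) (inner_polarAxis_equatorEmbed n w) r θ,
        hs, mul_zero, zero_smul]
    rw [coe_sphereKick, geodesicKick, ht, norm_zero, mul_zero, cos_zero, one_smul, smul_zero, add_zero]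
  · have hθ' : θ ∈ Ioo 0 π := by
      rcases eq_or_lt_of_le hθ.1 with h | h
      · exact absurd (by rw [← h, sin_zero]) hs
      rcases eq_or_lt_of_le hθ.2 with h' | h'
      · exact absurd (by rw [h', sin_pi]) hs
      exact ⟨h, h'⟩
    exact sphereKick_latitudePt n c hr hθ' w

/-- The update with field along the axis is injective on the sphere for `|c r| ≤ 1`. -/
theorem injective_sphereKick_polarAxis {c r : ℝ} (hr : 0 < r) (hκ : |c * r| ≤ 1) :
    Function.Injective (sphereKick c (r • polarAxis n)) := by
  intro x₁ x₂ h
  obtain ⟨w₁, h₁⟩ := exists_eq_latitudePt n x₁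
  obtain ⟨w₂, h₂⟩ := exists_eq_latitudePt n x₂
  set θ₁ := angle (polarAxis n) (x₁ : EuclideanSpace ℝ (Fin (n + 2))) with hθ₁
  set θ₂ := angle (polarAxis n) (x₂ : EuclideanSpace ℝ (Fin (n + 2))) with hθ₂
  have hI₁ : θ₁ ∈ Icc 0 π := ⟨angle_nonneg _ _, angle_le_pi _ _⟩
  have hI₂ : θ₂ ∈ Icc 0 π := ⟨angle_nonneg _ _, angle_le_pi _ _⟩
  rw [h₁, h₂, sphereKick_latitudePt_Icc n c hr hI₁, sphereKick_latitudePt_Icc n c hr hI₂] at h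
  have hk₁ := kickAngle_mem_Icc hκ hI₁
  have hk₂ := kickAngle_mem_Icc hκ hI₂
  -- equal images have equal polar angles, hence `θ₁ = θ₂`
  have hang := congrArg
    (fun z : sphere (0 : EuclideanSpace ℝ (Fin (n + 2))) 1 =>
      angle (polarAxis n) (z : EuclideanSpace ℝ (Fin (n + 2)))) h
  simp only [angle_polarAxis_latitudePt n hk₁, angle_polarAxis_latitudePt n hk₂] at hang
  have hθ : θ₁ = θ₂ := injective_kickAngle hκ hang
  rw [h₁, h₂, ← hθ]
  rw [← hθ] at h
  -- equal images have equal equatorial components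
  have htail := congrArg (fun z : sphere (0 : EuclideanSpace ℝ (Fin (n + 2))) 1 =>
    (axisCoords n (z : EuclideanSpace ℝ (Fin (n + 2)))).2) h
  simp only [axisCoords_latitudePt] at htail
  by_cases hsin : sin (kickAngle (c * r) θ₁) = 0
  · -- the image is a pole, so is the source: `θ₁ ∈ {0, π}` and `w` does not matter
    have hθ0 : sin θ₁ = 0 := by
      rcases eq_or_lt_of_le hk₁.1 with h0 | h0
      · have : θ₁ = 0 := injective_kickAngle hκ (by rw [← h0, kickAngle_zero])
        rw [this, sin_zero]
      rcases eq_or_lt_of_le hk₁.2 with hπ | hπ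
      · have : θ₁ = π := injective_kickAngle hκ (by rw [hπ, kickAngle_pi])
        rw [this, sin_pi]
      exact absurd hsin (sin_pos_of_pos_of_lt_pi h0 hπ).ne'
    apply Subtype.ext
    rw [coe_latitudePt, coe_latitudePt, hθ0, zero_smul, zero_smul]
  · have hw : (w₁ : EuclideanSpace ℝ (Fin (n + 1))) = w₂ := smul_right_injective _ hsin htail
    rw [Subtype.ext hw]

/-- The update with field along the axis is surjective on the sphere for `|c r| ≤ 1`. -/
theorem surjective_sphereKick_polarAxis {c r : ℝ} (hr : 0 < r) (hκ : |c * r| ≤ 1) :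
    Function.Surjective (sphereKick c (r • polarAxis n)) := by
  intro y
  obtain ⟨w, hy⟩ := exists_eq_latitudePt n y
  obtain ⟨θ, hθ, hk⟩ := (bijOn_kickAngle hκ).surjOn
    (⟨angle_nonneg _ _, angle_le_pi _ _⟩ :
      angle (polarAxis n) (y : EuclideanSpace ℝ (Fin (n + 2))) ∈ Icc 0 π)
  exact ⟨latitudePt n θ w, by rw [sphereKick_latitudePt_Icc n c hr hθ, hk, ← hy]⟩

/-- The update with field along the axis is a bijection of the sphere for `|c r| ≤ 1`. -/
theorem bijective_sphereKick_polarAxis {c r : ℝ} (hr : 0 < r) (hκ : |c * r| ≤ 1) :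
    Function.Bijective (sphereKick c (r • polarAxis n)) :=
  ⟨injective_sphereKick_polarAxis n hr hκ, surjective_sphereKick_polarAxis n hr hκ⟩

end Model

/-! ## §2 General position: a measurable bijection of the site sphere -/

section General

variable (n : ℕ) {V : Type*} [NormedAddCommGroup V] [InnerProductSpace ℝ V] [FiniteDimensional ℝ V]
  [MeasurableSpace V] [BorelSpace V]

/-- **The E–S site update is a bijection of the unit sphere** of any `(n+2)`-dimensional real inner
product space, for every local field `J` and step constant with `|c| ‖J‖ ≤ 1`. -/
theorem bijective_sphereKick (hV : Module.finrank ℝ V = n + 2) {c : ℝ} {J : V}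
    (hc : |c| * ‖J‖ ≤ 1) : Function.Bijective (sphereKick c J) := by
  rcases eq_or_ne J 0 with rfl | hJ
  · rw [show sphereKick c (0 : V) = id from funext (sphereKick_zero c)]
    exact Function.bijective_id
  have hr : 0 < ‖J‖ := norm_pos_iff.2 hJ
  have hκ : |c * ‖J‖| ≤ 1 := by rwa [abs_mul, abs_norm]
  obtain ⟨T, hT⟩ := exists_linearIsometryEquiv_apply_eq_polarAxis n hV (e := ‖J‖⁻¹ • J)
    (by rw [norm_smul, norm_inv, norm_norm, inv_mul_cancel₀ hr.ne'])
  have hTJ : T J = ‖J‖ • polarAxis n := by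
    rw [← hT, map_smul, smul_smul, mul_inv_cancel₀ hr.ne', one_smul]
  have hconj : sphereKick c J =
      (isoSphere T).symm ∘ sphereKick c (‖J‖ • polarAxis n) ∘ isoSphere T := by
    funext x
    have h := sphereKick_isoSphere_symm T c J (isoSphere T x)
    rw [MeasurableEquiv.symm_apply_apply, hTJ] at h
    exact h
  rw [hconj]
  exact (isoSphere T).symm.bijective.comp
    ((bijective_sphereKick_polarAxis n hr hκ).comp (isoSphere T).bijective)

/-- **The site update as a measurable equivalence of the sphere** (a continuous bijection of the
compact Hausdorff space `S(V)` is a homeomorphism). -/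
def sphereKickEquiv (hV : Module.finrank ℝ V = n + 2) {c : ℝ} {J : V} (hc : |c| * ‖J‖ ≤ 1) :
    sphere (0 : V) 1 ≃ᵐ sphere (0 : V) 1 :=
  (Continuous.homeoOfEquivCompactToT2 (f := Equiv.ofBijective _ (bijective_sphereKick n hV hc))
    (continuous_sphereKick c J)).toMeasurableEquiv

/-- The measurable equivalence is the site update. -/
@[simp] theorem coe_sphereKickEquiv (hV : Module.finrank ℝ V = n + 2) {c : ℝ} {J : V}
    (hc : |c| * ‖J‖ ≤ 1) : ⇑(sphereKickEquiv n hV hc) = sphereKick c J := rfl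

/-- E–S eq. (18) for the measurable equivalence (`SphereKickJacobianTransport.hasJacobian_sphereKick`). -/
theorem hasJacobian_sphereKickEquiv (hV : Module.finrank ℝ V = n + 2) (μ : Measure V)
    [μ.IsAddHaarMeasure] {c : ℝ} {J : V} (hc : |c| * ‖J‖ ≤ 1) :
    HasJacobian μ.toSphere (sphereKickEquiv n hV hc)
      fun x => ENNReal.ofReal (kickJac (c * ‖J‖) n (angle J (x : V))) := by
  rw [coe_sphereKickEquiv]
  exact hasJacobian_sphereKick' n hV μ hc

/-- **THMC with the Engel–Schaefer site map is exact (invariance).**  Let `V` be the site space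
(`dim V = n + 2`; CP(N−1): `ℂ^N ≅ ℝ^{2N}`, `n = 2N − 2`) with an additive Haar measure `μ` and
surface measure `μ.toSphere` on the site sphere, `J` the local field, `|c| ‖J‖ ≤ 1`, and
`p ≥ 0` any measurable weight on the sphere (the site's Boltzmann factor).  If an update `κ` of the
sphere leaves the PULLED-BACK weight `(p ∘ sphereKick c J) · kickJac(c‖J‖, n, angle J ·) · μ.toSphere`
invariant, then `κ` reported through the site map — `conjKernel κ (sphereKickEquiv …)`, i.e. pull
back, update, push forward (Lüscher's HMC in the trivializing-map variables, E–S §2.2) — leaves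
`p · μ.toSphere` invariant.  (`TransformedKernel.transformedUpdate_invariant` with the exact
Jacobian of E–S eq. (18).) -/
theorem sphereKick_thmc_invariant (hV : Module.finrank ℝ V = n + 2) (μ : Measure V)
    [μ.IsAddHaarMeasure] {c : ℝ} {J : V} (hc : |c| * ‖J‖ ≤ 1)
    {p : sphere (0 : V) 1 → ℝ≥0∞} (hp : Measurable p) {κ : Kernel (sphere (0 : V) 1) (sphere (0 : V) 1)}
    (hκ : Invariant κ (μ.toSphere.withDensity fun x =>
      p (sphereKick c J x) * ENNReal.ofReal (kickJac (c * ‖J‖) n (angle J (x : V))))) :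
    Invariant (conjKernel κ (sphereKickEquiv n hV hc)) (μ.toSphere.withDensity p) :=
  transformedUpdate_invariant (hasJacobian_sphereKickEquiv n hV μ hc) hp hκ

/-- **THMC with the Engel–Schaefer site map is exact (detailed balance).**  The same for
reversibility: a `((p ∘ sphereKick) · kickJac) · μ.toSphere`-reversible update reported through the
site map is `p · μ.toSphere`-reversible. -/
theorem sphereKick_thmc_isReversible (hV : Module.finrank ℝ V = n + 2) (μ : Measure V)
    [μ.IsAddHaarMeasure] {c : ℝ} {J : V} (hc : |c| * ‖J‖ ≤ 1)
    {p : sphere (0 : V) 1 → ℝ≥0∞} (hp : Measurable p) {κ : Kernel (sphere (0 : V) 1) (sphere (0 : V) 1)}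
    (hκ : IsReversible κ (μ.toSphere.withDensity fun x =>
      p (sphereKick c J x) * ENNReal.ofReal (kickJac (c * ‖J‖) n (angle J (x : V))))) :
    IsReversible (conjKernel κ (sphereKickEquiv n hV hc)) (μ.toSphere.withDensity p) :=
  transformedUpdate_isReversible (hasJacobian_sphereKickEquiv n hV μ hc) hp hκ

/-- **The autocorrelation dictionary for the site map** (`TransformedKernel.correlation_conjKernel`):
for any observable `O` on the sphere and any start law `ν`, the lag-one correlation of `O` along the
reported chain started from `(sphereKick c J)_* ν` equals that of `O ∘ sphereKick c J` along `κ`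
started from `ν`. -/
theorem sphereKick_thmc_correlation (hV : Module.finrank ℝ V = n + 2) {c : ℝ} {J : V}
    (hc : |c| * ‖J‖ ≤ 1) (κ : Kernel (sphere (0 : V) 1) (sphere (0 : V) 1))
    (ν : Measure (sphere (0 : V) 1)) (O : sphere (0 : V) 1 → ℝ) :
    ∫ x, O x * (∫ y, O y ∂(conjKernel κ (sphereKickEquiv n hV hc) x))
        ∂(ν.map (sphereKick c J)) =
      ∫ v, O (sphereKick c J v) * (∫ w, O (sphereKick c J w) ∂(κ v)) ∂ν :=
  correlation_conjKernel κ (sphereKickEquiv n hV hc) ν O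

end General

end Summit.Ventures.LatticeQCDFlow.Exactness

end
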